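import Mathlib
import Summits.KontsevichZagierPeriods.Zeta5Search.LaiBoxReflection
import Summits.KontsevichZagierPeriods.Zeta5Search.CriteriaDimension
import Summits.KontsevichZagierPeriods.Zeta5Search.Certificates.RowOfRecurrence
import Literature.NumberTheory.LFunctions.LcmUptoCubeBound
import HarnessLib

/-!
# The κ₃-ladder certificate for Lai's block box (typed criterion instance, shape I at general length)

HONEST FRAMING: systematic search; no irrationality claim unless certified. Nothing in this file
asserts a dimension or irrationality statement: it fixes, once and for all, the SHAPE of the data a
family of Lai-box linear forms must deliver for the mechanical conclusion
`dim_ℚ Span_ℚ(1, ζ(3), ζ(5), …, ζ(2m+1)) ≥ 3`, and proves the two hypothesis-free parts.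

Pub cell `pub-zeta5`, lane fam-indep (criterion side of the T2/T4 targets; `families/indep/FAMILY.md`
§5.10–§5.12). The record in print for `κ₃ := min {a odd : dim_ℚ Span_ℚ(1, ζ3, ζ5, …, ζ(a)) ≥ 3}` is
`κ₃ ≤ 139` [FischlerZudilin2010, Thm 3]; Lai [Lai2024BallRivoal, Claim 1.4] claims `κ₃ ≤ 75` from the
block rational functions `R̃_n` of his §13 (tree: `laiCore`, `LaiBoxReflection.lean`) by feeding their
linear forms to the refined criterion [FischlerZudilin2010, Thm 2] = tree
`Literature.NumberTheory.Irrationality.FischlerZudilin2010.theorem2_holds` (PROVED there), packaged for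
rates `σ, Q, ψ` as `finrank_three_of_divisorForms_general` (`CriteriaDimension.lean`).

This file:
* `oddZetaVec m = (1, ζ(3), ζ(5), …, ζ(2m+1))` and `oddZetaSpanRank m` = `dim_ℚ` of its ℚ-span
  (`κ₃ ≤ 2m+1` reads `3 ≤ oddZetaSpanRank m`), monotone in `m` (`oddZetaSpanRank_mono`).
* `LaiBoxDimCertificate J r M δ m` — the data: rational coefficients `coef n s` with
  `Σ_{k≥0} R̃_n(k+1) = coef n 0 + Σ_{3≤s≤J, s odd} coef n s · ζ(s)` (for even `J` these EXIST by
  `laiBox_hasSum_oddZeta`, i.e. Cresson–Fischler–Rivoal 2008 Thm 1 — see `laiBoxCoef`), an integer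
  normaliser `norm n` making `ℓ n i := norm n · coef n (2i+1)` integers, the decay rate `σ` OF LAI'S
  SERIES `|norm n · Σ_k R̃_n(k+1)|^{1/n} → e^{−σ}`, the growth rate `Q` of the `ℓ n i`, a divisor
  `divisor n ∣ ℓ n i` (`i ≠ 0`) with `e^{ψ n} ≤ gcd(divisor n, divisor (n+1))` eventually, and the
  margin `Q < σ + ψ` (FAMILY.md §5.1: index `1 + (σ+ψ)/Q > 2`).
* `three_le_oddZetaSpanRank_of_laiBoxDimCertificate` — certificate ⇒ `dim ≥ 3` (PROVED: reindexing the odd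
  zeta values + `finrank_three_of_divisorForms_general`).
* `gcdRate_lcmUpto_pow` — the divisor hypothesis DISCHARGED for the standard divisors
  `divisor n = lcm(1..c n)^k` (Lai's `D_{(M−δ₁)n}^3`, [Lai2024BallRivoal, §13]; Fischler–Zudilin's `d_n^3`):
  `e^{ψ n} ≤ gcd(lcm(1..cn)^k, lcm(1..c(n+1))^k)` eventually for every `ψ < c k` (prime number theorem,
  tree `tendsto_log_lcmUpto_mul_div'`).

What remains OPEN for any concrete point of the box (and is NOT claimed): the decay rate `σ` (Lai's
Lemma 5.1 saddle asymptotics with the closed form of his p. 49), the growth rate `Q` (Lemma 4.4 + 5.2 +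
the prime saving `ϖ̃` of §13, an author-labelled CLAIM resting on a computation), and the integrality of
the normalised coefficients (Lemma 4.4 for the plain saving `Φ_n`; the refined saving `Φ̃_n` of §13,
which also counts the numerator bricks, is stated there without proof — it follows brick by brick from
[Zudilin2004, Lemmas 17–18] by the Leibniz-rule argument of [Lai2024BallRivoal, Lemma 4.3], but that
derivation is not written out in print). MODEL-LEVEL numbers for the cell's candidates live in
FAMILY.md §5.10–§5.11 only.
-/

noncomputable section

open Filter Topology Finset
open Literature.NumberTheory.Transcendental

namespace Summit.KontsevichZagierPeriods.Zeta5Search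

/-! ### The odd-zeta vectors and the `dim ≥ 3` ladder statement -/

/-- `oddZetaVec m = (1, ζ(3), ζ(5), …, ζ(2m+1)) : Fin (m+1) → ℝ` (`i ↦ ζ(2i+1)` for `i ≠ 0`). -/
def oddZetaVec (m : ℕ) : Fin (m + 1) → ℝ :=
  fun i => if (i : ℕ) = 0 then 1 else zetaValue (2 * i + 1)

/-- The `0`-th coordinate of `oddZetaVec` is `1`. -/
@[simp] theorem oddZetaVec_zero (m : ℕ) : oddZetaVec m 0 = 1 := by simp [oddZetaVec]

/-- The successor coordinates of `oddZetaVec` are the odd zeta values. -/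
theorem oddZetaVec_succ (m : ℕ) (i : Fin m) :
    oddZetaVec m i.succ = zetaValue (2 * ((i : ℕ) + 1) + 1) := by
  simp [oddZetaVec, Fin.val_succ]

/-- Nonzero coordinates of `oddZetaVec`. -/
theorem oddZetaVec_of_ne_zero (m : ℕ) (i : Fin (m + 1)) (hi : (i : ℕ) ≠ 0) :
    oddZetaVec m i = zetaValue (2 * i + 1) := by
  simp [oddZetaVec, hi]

/-- `oddZetaSpanRank m = dim_ℚ Span_ℚ(1, ζ(3), ζ(5), …, ζ(2m+1))`. The ladder statement
"`κ₃ ≤ 2m+1`" is `3 ≤ oddZetaSpanRank m`: in print for `m = 69` (ζ(139)) [FischlerZudilin2010, Thm 3];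
claimed for `m = 37` (ζ(75)) [Lai2024BallRivoal, Claim 1.4]; conjecturally for `m = 2`. NOT asserted
here for any `m`. -/
def oddZetaSpanRank (m : ℕ) : ℕ :=
  Module.finrank ℚ (Submodule.span ℚ (Set.range (oddZetaVec m)))

/-- The ranges of `oddZetaVec` increase with `m`. -/
theorem range_oddZetaVec_subset {m m' : ℕ} (h : m ≤ m') :
    Set.range (oddZetaVec m) ⊆ Set.range (oddZetaVec m') := by
  rintro x ⟨i, rfl⟩
  refine ⟨⟨i, by omega⟩, ?_⟩
  simp [oddZetaVec]

/-- The ladder is monotone: `oddZetaSpanRank m ≤ oddZetaSpanRank m'` for `m ≤ m'`. -/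
theorem oddZetaSpanRank_mono {m m' : ℕ} (h : m ≤ m') : oddZetaSpanRank m ≤ oddZetaSpanRank m' := by
  unfold oddZetaSpanRank
  have hle : Submodule.span ℚ (Set.range (oddZetaVec m)) ≤
      Submodule.span ℚ (Set.range (oddZetaVec m')) :=
    Submodule.span_mono (range_oddZetaVec_subset h)
  haveI : Module.Finite ℚ (Submodule.span ℚ (Set.range (oddZetaVec m'))) :=
    Module.Finite.span_of_finite ℚ (Set.finite_range _)
  exact Submodule.finrank_mono hle

/-- Set form of the rung vector, in the shape of the tree's printed dimension facts
(`Literature.NumberTheory.Transcendental.ball_rivoal`: the span of `insert 1 {ζ(k) : k odd, 3 ≤ k ≤ a}`):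
`range (oddZetaVec m) = insert 1 {ζ(k) : k odd, 3 ≤ k ≤ 2m+1}`. -/
theorem range_oddZetaVec_eq (m : ℕ) :
    Set.range (oddZetaVec m) =
      insert (1 : ℝ) {x | ∃ k : ℕ, Odd k ∧ 3 ≤ k ∧ k ≤ 2 * m + 1 ∧ x = zetaValue k} := by
  ext x
  simp only [Set.mem_range, Set.mem_insert_iff, Set.mem_setOf_eq]
  constructor
  · rintro ⟨i, rfl⟩
    by_cases hi : (i : ℕ) = 0
    · left; simp [oddZetaVec, hi]
    · right
      refine ⟨2 * i + 1, ⟨i, by ring⟩, by omega, by omega, ?_⟩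
      simp [oddZetaVec, hi]
  · rintro (rfl | ⟨k, ⟨j, rfl⟩, h3, hk, rfl⟩)
    · exact ⟨0, by simp⟩
    · refine ⟨⟨j, by omega⟩, ?_⟩
      have hj : (j : ℕ) ≠ 0 := by omega
      simp [oddZetaVec, hj]

/-- Hence `oddZetaSpanRank m = dim_ℚ Span_ℚ(insert 1 {ζ(k) : k odd, 3 ≤ k ≤ 2m+1})`: the printed rungs
(Ball–Rivoal: tree `ball_rivoal_holds`; Fischler–Zudilin's `κ₃ ≤ 139` [FischlerZudilin2010, §3.1 proof of
Thm 3, `s = 70, t = 10`]) read on this ladder by rewriting. -/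
theorem oddZetaSpanRank_eq_finrank_span_insert (m : ℕ) :
    oddZetaSpanRank m = Module.finrank ℚ (Submodule.span ℚ
      (insert (1 : ℝ) {x | ∃ k : ℕ, Odd k ∧ 3 ≤ k ∧ k ≤ 2 * m + 1 ∧ x = zetaValue k})) := by
  rw [oddZetaSpanRank, range_oddZetaVec_eq]

/-- The rung `m = 3` is the cell's T2 vector: `oddZetaVec 3 = thetaFour = (1, ζ3, ζ5, ζ7)`. -/
theorem oddZetaVec_three : oddZetaVec 3 = thetaFour := by
  funext i
  fin_cases i <;> simp [oddZetaVec, thetaFour]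

/-- The rung `m = 4`: `oddZetaVec 4 = thetaFive = (1, ζ3, ζ5, ζ7, ζ9)`. -/
theorem oddZetaVec_four : oddZetaVec 4 = thetaFive := by
  funext i
  fin_cases i <;> simp [oddZetaVec, thetaFive]

/-- **T2 read off the ladder**: `3 ≤ oddZetaSpanRank 3` (i.e. `κ₃ ≤ 7`) gives "one of `ζ(5), ζ(7)` is
irrational" (`zetaFiveOrSeven_of_finrank_three`); NOT asserted. -/
theorem zetaFiveOrSeven_of_oddZetaSpanRank_three (h : 3 ≤ oddZetaSpanRank 3) :
    Irrational (zetaValue 5) ∨ Irrational (zetaValue 7) := by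
  unfold oddZetaSpanRank at h
  rw [oddZetaVec_three] at h
  exact zetaFiveOrSeven_of_finrank_three h

/-- `3 ≤ oddZetaSpanRank 4` (`κ₃ ≤ 9`) gives "one of `ζ(5), ζ(7), ζ(9)` is irrational"; NOT asserted. -/
theorem zetaFiveSevenNine_of_oddZetaSpanRank_four (h : 3 ≤ oddZetaSpanRank 4) :
    Irrational (zetaValue 5) ∨ Irrational (zetaValue 7) ∨ Irrational (zetaValue 9) := by
  unfold oddZetaSpanRank at h
  rw [oddZetaVec_four] at h
  exact zetaFiveSevenNine_of_finrank_three' h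

/-! ### Reindexing: odd `s ∈ [3, 2m+2]` ↔ `i ∈ [1, m]`, `s = 2i+1` -/

/-- Reindexing the odd integers of `[3, 2m+2]` as `2i+3`, `i < m`. -/
theorem filter_odd_Icc_eq_image (m : ℕ) :
    (Icc 3 (2 * m + 2)).filter Odd = (range m).image (fun i => 2 * i + 3) := by
  ext s
  simp only [mem_filter, mem_Icc, mem_image, mem_range]
  constructor
  · rintro ⟨⟨h3, hs⟩, ⟨k, hk⟩⟩
    exact ⟨k - 1, by omega, by omega⟩
  · rintro ⟨i, hi, rfl⟩
    exact ⟨⟨by omega, by omega⟩, ⟨i + 1, by ring⟩⟩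

/-! ### The certificate -/

/-- **Lai-box `dim ≥ 3` certificate** at block data `(J, r, M, δ)` for the vector
`(1, ζ3, …, ζ(2m+1))`, `J = 2m+2` [Lai2024BallRivoal, §13; FischlerZudilin2010, Thm 2]. Fields = exactly
the hypotheses of `finrank_three_of_divisorForms_general`, with the small linear form pinned to Lai's
series `norm n · Σ_{k≥0} R̃_n(k+1)` (`laiCore J r M n δ (k+1) = R̃_n(k+1)/C_n`). The rates are per step
`n` in nats (FAMILY.md §5.1 units: `σ = c − δ + φ`, `Q = b + δ − φ`, `ψ` = divisor rate). -/
structure LaiBoxDimCertificate (J r M : ℕ) (δ : Fin J → ℕ) (m : ℕ) where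
  /-- `J = 2m + 2` unit blocks: the forms live in `ℚ + ℚζ(3) + ⋯ + ℚζ(2m+1)`. -/
  hJ : J = 2 * m + 2
  /-- rational coefficients of the decomposition of Lai's series at step `n` (`coef n s`, `s = 0` or odd) -/
  coef : ℕ → ℕ → ℚ
  /-- `Σ_{k≥0} R̃_n(k+1)/C_n = coef n 0 + Σ_{3 ≤ s ≤ J, s odd} coef n s · ζ(s)` -/
  hasSum : ∀ n : ℕ, HasSum (fun k : ℕ => ((laiCore J r M n δ ((k : ℚ) + 1) : ℚ) : ℝ))
    ((coef n 0 : ℝ) + ∑ s ∈ (Icc 3 J).filter Odd, (coef n s : ℝ) * zetaValue s)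
  /-- integer normaliser (Lai: `Φ̃_n^{-1} ∏_j D_{M_j n}` times the constant `C_n`) -/
  norm : ℕ → ℤ
  /-- the integer forms: `ℓ n 0 = norm n · coef n 0`, `ℓ n i = norm n · coef n (2i+1)` -/
  ℓ : ℕ → Fin (m + 1) → ℤ
  ℓ_zero : ∀ n : ℕ, ((ℓ n 0 : ℤ) : ℚ) = norm n * coef n 0
  ℓ_odd : ∀ (n : ℕ) (i : Fin m), ((ℓ n i.succ : ℤ) : ℚ) = norm n * coef n (2 * ((i : ℕ) + 1) + 1)
  /-- decay rate, growth rate, divisor rate -/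
  σ : ℝ
  Q : ℝ
  ψ : ℝ
  hσ : 0 < σ
  hQ : 0 < Q
  /-- `|norm n · Σ_k R̃_n(k+1)/C_n|^{1/n} → e^{−σ}` (Lai Lemma 5.1-type statement; OPEN per point) -/
  decay : Tendsto (fun n : ℕ =>
      |(norm n : ℝ) * ∑' k : ℕ, ((laiCore J r M n δ ((k : ℚ) + 1) : ℚ) : ℝ)| ^ ((1 : ℝ) / n))
    atTop (𝓝 (Real.exp (-σ)))
  /-- `|ℓ n i| ≤ e^{Q' n}` eventually, every `Q' > Q` (Lemma 4.4 + 5.2 + prime saving; OPEN per point) -/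
  growth : ∀ i : Fin (m + 1), ∀ Q' : ℝ, Q < Q' → ∀ᶠ n : ℕ in atTop, |(ℓ n i : ℝ)| ≤ Real.exp (Q' * n)
  /-- a common divisor of the zeta-coefficients -/
  divisor : ℕ → ℕ
  dvd : ∀ n : ℕ, 1 ≤ n → 0 < divisor n ∧ ∀ i : Fin (m + 1), i ≠ 0 → (divisor n : ℤ) ∣ ℓ n i
  /-- `e^{ψ n} ≤ gcd(divisor n, divisor (n+1))` eventually (for `lcm(1..cn)^k`: `gcdRate_lcmUpto_pow`) -/
  gcdRate : ∀ᶠ n : ℕ in atTop,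
    Real.exp (ψ * n) ≤ ((Nat.gcd (divisor n) (divisor (n + 1)) : ℕ) : ℝ)
  /-- the margin: index `1 + (σ + ψ)/Q > 2` -/
  margin : Q < σ + ψ

namespace LaiBoxDimCertificate

variable {J r M : ℕ} {δ : Fin J → ℕ} {m : ℕ} (c : LaiBoxDimCertificate J r M δ m)

/-- The value of the integer form is the normalised value of Lai's series. -/
theorem sum_forms_eq (n : ℕ) :
    ∑ i, (c.ℓ n i : ℝ) * oddZetaVec m i =
      (c.norm n : ℝ) * ∑' k : ℕ, ((laiCore J r M n δ ((k : ℚ) + 1) : ℚ) : ℝ) := by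
  have hI : (Icc 3 J).filter Odd = (range m).image (fun i => 2 * i + 3) := by
    rw [c.hJ]; exact filter_odd_Icc_eq_image m
  rw [(c.hasSum n).tsum_eq, hI, sum_image (fun i _ j _ h => by omega), Fin.sum_univ_succ]
  have h0 : (c.ℓ n 0 : ℝ) * oddZetaVec m 0 = (c.norm n : ℝ) * (c.coef n 0 : ℝ) := by
    rw [oddZetaVec_zero, mul_one]
    have := congrArg (fun q : ℚ => (q : ℝ)) (c.ℓ_zero n)
    simpa using this
  have hs : ∀ i : Fin m, (c.ℓ n i.succ : ℝ) * oddZetaVec m i.succ =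
      (c.norm n : ℝ) * ((c.coef n (2 * ((i : ℕ) + 1) + 1) : ℝ) * zetaValue (2 * ((i : ℕ) + 1) + 1)) := by
    intro i
    rw [oddZetaVec_succ, ← mul_assoc]
    congr 1
    have := congrArg (fun q : ℚ => (q : ℝ)) (c.ℓ_odd n i)
    simpa using this
  rw [h0, Finset.sum_congr rfl (fun i _ => hs i), ← mul_sum, ← mul_add]
  congr 1
  rw [Fin.sum_univ_eq_sum_range (fun i => (c.coef n (2 * (i + 1) + 1) : ℝ) * zetaValue (2 * (i + 1) + 1)) m]
  congr 1

end LaiBoxDimCertificate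

/-- **Certificate ⇒ `dim_ℚ Span_ℚ(1, ζ3, …, ζ(2m+1)) ≥ 3`** (`m ≥ 1`). PROVED assembly: the value
identity `LaiBoxDimCertificate.sum_forms_eq` + `finrank_three_of_divisorForms_general`
(= [FischlerZudilin2010, Thm 2], tree `theorem2_holds`). No instance is claimed. -/
theorem three_le_oddZetaSpanRank_of_laiBoxDimCertificate {J r M : ℕ} {δ : Fin J → ℕ} {m : ℕ}
    (hm : 1 ≤ m) (c : LaiBoxDimCertificate J r M δ m) : 3 ≤ oddZetaSpanRank m := by
  have hL : Tendsto (fun n : ℕ => |∑ i, (c.ℓ n i : ℝ) * oddZetaVec m i| ^ ((1 : ℝ) / n)) atTop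
      (𝓝 (Real.exp (-c.σ))) :=
    c.decay.congr (fun n => by rw [c.sum_forms_eq n])
  unfold oddZetaSpanRank
  exact finrank_three_of_divisorForms_general m hm (oddZetaVec m) c.ℓ c.divisor c.hσ c.hQ hL
    c.growth c.dvd c.gcdRate c.margin

/-- Same, read as a rung of the ladder: a certificate at `J = 2m+2` blocks gives `dim ≥ 3` for every
`(1, ζ3, …, ζ(2m'+1))`, `m' ≥ m`. -/
theorem three_le_oddZetaSpanRank_of_laiBoxDimCertificate_le {J r M : ℕ} {δ : Fin J → ℕ}
    {m m' : ℕ} (hm : 1 ≤ m) (hmm' : m ≤ m') (c : LaiBoxDimCertificate J r M δ m) :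
    3 ≤ oddZetaSpanRank m' :=
  (three_le_oddZetaSpanRank_of_laiBoxDimCertificate hm c).trans (oddZetaSpanRank_mono hmm')

/-! ### The hypothesis-free fields

(1) The coefficients: for even `J ≥ 2`, `2δ_j ≤ M` and the degree condition, a decomposition as in
the field `hasSum` EXISTS (`laiBox_hasSum_oddZeta`, from Cresson–Fischler–Rivoal 2008 Thm 1); a
certificate may take `coef n := laiBoxCoef … n`. (Explicit partial fractions give the same sums.) -/

/-- A choice of the rational coefficients of Lai's series at step `n` (exists by `laiBox_hasSum_oddZeta`). -/
def laiBoxCoef (J r M n : ℕ) (δ : Fin J → ℕ) (hJ : Even J) (hJ1 : 1 ≤ J) (hδ : ∀ j, 2 * δ j ≤ M)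
    (hdeg : 1 + 2 * (r * n) + (∑ j, 2 * (δ j * n)) + 2 ≤ J * (M * n + 1)) : ℕ → ℚ :=
  Classical.choose (laiBox_hasSum_oddZeta J r M n δ hJ hJ1 hδ hdeg)

/-- The defining property of `laiBoxCoef` (chosen coefficients of `laiBox_hasSum_oddZeta`). -/
theorem laiBoxCoef_hasSum (J r M n : ℕ) (δ : Fin J → ℕ) (hJ : Even J) (hJ1 : 1 ≤ J)
    (hδ : ∀ j, 2 * δ j ≤ M) (hdeg : 1 + 2 * (r * n) + (∑ j, 2 * (δ j * n)) + 2 ≤ J * (M * n + 1)) :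
    HasSum (fun k : ℕ => ((laiCore J r M n δ ((k : ℚ) + 1) : ℚ) : ℝ))
      ((laiBoxCoef J r M n δ hJ hJ1 hδ hdeg 0 : ℝ) +
        ∑ s ∈ (Icc 3 J).filter Odd, (laiBoxCoef J r M n δ hJ hJ1 hδ hdeg s : ℝ) * zetaValue s) :=
  Classical.choose_spec (laiBox_hasSum_oddZeta J r M n δ hJ hJ1 hδ hdeg)

/-! (2) The divisor rate for the standard divisors `lcm(1..c n)^k` — PROVED (prime number theorem). -/

/-- `lcm(1..c n)^k ∣ lcm(1..c(n+1))^k`, so the gcd of consecutive standard divisors is the first. -/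
theorem gcd_lcmUpto_pow_succ (c k n : ℕ) :
    Nat.gcd (Nat.lcmUpto (c * n) ^ k) (Nat.lcmUpto (c * (n + 1)) ^ k) = Nat.lcmUpto (c * n) ^ k :=
  Nat.gcd_eq_left (pow_dvd_pow_of_dvd
    (Literature.NumberTheory.LFunctions.lcmUpto_dvd_lcmUpto_of_le (Nat.mul_le_mul_left c (Nat.le_succ n))) k)

/-- **The divisor-rate hypothesis, discharged for `divisor n = lcm(1..c n)^k`:** for every `ψ < c·k`,
`e^{ψ n} ≤ gcd(lcm(1..cn)^k, lcm(1..c(n+1))^k)` for all large `n` (PNT: `log lcm(1..cn)/n → c`, tree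
`tendsto_log_lcmUpto_mul_div'`). With `c = M − δ₁`, `k = 3` this is the rate `ψ = γ₁ = 3(M−δ₁)` of
[Lai2024BallRivoal, §13] up to every `ε > 0`; with `c = 1`, `k = 3` Fischler–Zudilin's `d_n^3`. -/
theorem gcdRate_lcmUpto_pow (c k : ℕ) {ψ : ℝ} (hψ : ψ < (c : ℝ) * k) :
    ∀ᶠ n : ℕ in atTop, Real.exp (ψ * n) ≤
      ((Nat.gcd (Nat.lcmUpto (c * n) ^ k) (Nat.lcmUpto (c * (n + 1)) ^ k) : ℕ) : ℝ) := by
  rcases Nat.eq_zero_or_pos k with rfl | hk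
  · -- `k = 0`: the divisor is `1` and `ψ < 0`
    have hψ0 : ψ < 0 := by simpa using hψ
    filter_upwards [eventually_ge_atTop 0] with n _
    rw [gcd_lcmUpto_pow_succ, pow_zero, Nat.cast_one]
    exact Real.exp_le_one_iff.2 (mul_nonpos_of_nonpos_of_nonneg hψ0.le (Nat.cast_nonneg n))
  · have hk' : (0 : ℝ) < k := by exact_mod_cast hk
    have hlt : ψ / k < c := by rw [div_lt_iff₀ hk']; exact hψ
    have hev := (tendsto_log_lcmUpto_mul_div' c).eventually (Ioi_mem_nhds hlt)
    filter_upwards [hev, eventually_gt_atTop 0] with n hn hn0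
    rw [gcd_lcmUpto_pow_succ, Nat.cast_pow]
    have hpos : (0 : ℝ) < Nat.lcmUpto (c * n) := by exact_mod_cast Nat.lcmUpto_pos _
    have hn0' : (0 : ℝ) < n := by exact_mod_cast hn0
    rw [lt_div_iff₀ hn0'] at hn
    -- `ψ n ≤ k log lcm(1..cn)`
    have hle : ψ * n ≤ (k : ℝ) * Real.log (Nat.lcmUpto (c * n)) := by
      have : ψ / k * n < Real.log (Nat.lcmUpto (c * n)) := hn
      have h2 : ψ * n = k * (ψ / k * n) := by field_simp
      rw [h2]
      exact (mul_lt_mul_of_pos_left this hk').le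
    calc Real.exp (ψ * n) ≤ Real.exp ((k : ℝ) * Real.log (Nat.lcmUpto (c * n))) :=
          Real.exp_le_exp.2 hle
      _ = (Nat.lcmUpto (c * n) : ℝ) ^ k := by
          rw [← Real.log_pow, Real.exp_log (pow_pos hpos k)]

end Summit.KontsevichZagierPeriods.Zeta5Search
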